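import Summits.BirchSwinnertonDyer.BirchSwinnertonDyer.Theorems.MordellShaFreeCutKatoZetaRoadNontrivialH1
import HarnessLib

set_option linter.dupNamespace false
set_option autoImplicit false

/-! # Route `MordellShaFreeCut` (rung S2b) — crux B `AnalyticRankOneOfRankOneFiniteShaThree`
# (stmt-BirchSwinnertonDyer-19160): the Kato–zeta road consumes only the ANNIHILATION HALF of Perrin-Riou's
# formula at the additive prime `3` — «Heegner point torsion ⟹ the pinned Kato class has `3`-adic Kummer
# logarithm `0`» (no constant `c`, no embedding `ι : K → ℚ₃`)

Cell `bsd-cn100`, prover seat `bsd-cn100-s2b-c3` (g22). THEOREMS ONLY (0 `def`, 0 new named fact); supports, does not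
close, stmt-BirchSwinnertonDyer-19160. PARTITION: none — RANK axis. A DESIGN DATUM for the registered line
`kato-zeta-perrin-riou` v1h (skeleton sha256 5febefdc…; stubs `stub_refereedInputs` = RI7′ and
`stub_prFormulaAtThree : PRFormulaAtThreeH2`); no registry act is asked or implied — re-cuts are the plan's.

## The finding (kernel-checked below)

In the landed compositions `MordellShaFreeCutKatoZetaRoadPinnedH2.heegnerNonTorsion_of_prFormulaH2_of_readings`
(p467387) and `MordellShaFreeCutKatoZetaRoadPinnedH2AtPin.heegnerNonTorsion_of_prFormulaH2_of_readingsAtPin` (p515432)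
the research statement `PRFormulaAtThreeH2` — «… `∃ c ≠ 0`, `log(loc₃ ι[z]) = c · log_ω(P)²` in the Kummer currency» —
is consumed through `obtain ⟨c, -, hPRx⟩`: the conjunct `c ≠ 0` is DISCARDED, and the formula is used only at a
TORSION Heegner point `P` (the proof is by contradiction from `IsOfFinAddOrder P`), where `log_ω(P) = 0`
(`AcPConverseLinks.padicLogPoint_formalIndex_smul_eq_zero_of_isOfFinAddOrder`) turns it into
`HasLocPKummerLog W 3 pin.katoClass 0`. Hence the road needs only the following statement, displayed in this file
as the hypothesis schema `hV` (no `def`: naming is the typer's / the plan's if the design is adopted):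

  (V₃) for every globally minimal elliptic `W/ℚ` with `j(W) = 0`, every imaginary quadratic `K` with the Heegner
  hypothesis for `N = N(W)` and for `3` and with `L(W^{(d_K)}, 1) ≠ 0`, every Heegner point `P ∈ W(K)` of level
  `N` which is TORSION, if `L(W, 1) = 0` then every v2-pinned Kato descent datum `D` of `(W, 3)` satisfying
  Kato's Main Conjecture 12.10 in `Λ ⊗ ℚ₃` has `HasLocPKummerLog W 3 pin.katoClass 0` — the localisation at `3`
  of (a non-zero multiple of) Kato's class is the Kummer class of a point of logarithm `0`.

By Gross–Zagier over `K` (conjunct 6 of RI7′) and `L(W^{(d_K)},1) ≠ 0`, «`P` torsion» is «`ord_{s=1} L(W,s) ≠ 1`»,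
and the root number forced by the Heegner hypothesis with `L(W^{(d_K)},1) ≠ 0` makes it «`ord_{s=1} L(W,s) ≥ 3`»:
(V₃) is, for `j = 0` curves at `p = 3` and in the local Kummer currency, a CONSEQUENCE of the (⟹) half of
Perrin-Riou's Conjecture 3.3.2 («`L(f,s)` a un zéro d'ordre `> 1` en `1` ⟹ the bottom class of the zeta element
vanishes»; stated there at primes of good reduction — for arbitrary `(E, p)` the shape is Burungale–Skinner–Tian–Wan's
Conj. 1.12 (a)+(b)) and the reading of Bertolini–Darmon–Venerucci's Thm. A at a torsion `P`
(«`log_{ω_A}(res_p ζ^Kato_A) = log²_{ω_A}(P)` up to `ℚ^×`, `P` of infinite order iff the zero is simple»; printed for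
SEMISTABLE odd `p` only; every `j = 0` curve is ADDITIVE at `3`). (V₃) is implied by `PRFormulaAtThreeH2` (§1), so it
inherits every truth caveat of the registered stub and adds none. It says nothing at curves of
analytic rank one — the non-vanishing half of the formula (`c ≠ 0`), which the road never uses because it gets
«`ι[z]` non-torsion with Kummer log `≠ 0`» from (R1)/(R2)/(3.1′)/(3.1″) under the crux hypotheses.

## Contents

* §1 `logZeroAtThree_of_prFormulaH2` — MONOTONICITY: `PRFormulaAtThreeH2 → (V₃)` (the registered research stub
  implies the weaker statement; an embedding `K → ℚ₃` at a degree-one prime exists by the Heegner hypothesis for `3`,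
  `Rank1Residual.X11b.embAt`; a torsion point has `log_ω = 0`). The converse is not claimed.
* §2 `heegnerNonTorsion_of_logZero_of_readingsAtPin` — the at-the-pin composition of p515432 with `hPR` replaced
  by `hV` (same displayed readings (R+K) `hRK`, (3.1′) `h31`, (3.1″) `h31b`; the proof no longer chooses `ι`).
* §3 `cruxB_of_logZero_of_readingsAtPin` — crux B by name (`analyticRankOne_of_facts_of_heegnerNonTorsion`, p419697).
* §4 the census keyed to the registered line: `cruxB_of_sixFacts_of_nontrivialAtPin_of_logZero` (readings fed from
  (NT) by `MordellShaFreeCutKatoZetaRoadNontrivialH1` §1) and **`cruxB_of_registeredRI7prime_of_logZero`**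
  (RI7′ token for token as registered ∧ (V₃) ⟹ crux B). The registered road FACTORS through (V₃):
  `cruxB_of_registeredRI7prime_of_logZero RI (logZeroAtThree_of_prFormulaH2 hPR)` re-proves, term for term, the
  statement of `…NontrivialH1.cruxB_of_registeredRI7prime_of_prFormulaH2` (p526335) — not re-declared here
  (`dedup.landed`), so the weakening loses nothing the line uses.

NUMBERS: crux B ⟸ 7 citation-borne facts (RI7′) + ONE research statement (V₃) that is implied by the registered
one and drops from it the constant `c ≠ 0` and the datum `ι`; 0 sorry; standard axioms.

HONEST FRAMING. (V₃) is OPEN exactly like `PRFormulaAtThreeH2` (0 sources at an additive prime: BDV22 Thm. A needs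
semistable `p`, BSTW24 Thm. 1.13 needs `p ∤ 2N`; LIT-G18 §1); this file does not make it more provable, it only
shows that the weaker half suffices and is all the line uses. Nothing about (V₃), `PRFormulaAtThreeH2`, the seven
citation-borne inputs, crux B, the leaf `rankOne_threeConverse_mordellCurve`, Sylvester's problem or any case of BSD
is proved here; BSD is not proved by any of this. Build rule (H): concludes the route decl BY NAME through the S2b
cone (`…NontrivialH1` → `…PinnedH2AtPin` → `…PinnedH2` → `MordellShaFreeCutOfHeegnerNonTorsion`).

References: [PerrinRiou1993AIF] §3.3, Prop. 3.3.1, Conj. 3.3.2, Formule 3.3.4 (pp. 975–977);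
[BertoliniDarmonVenerucci2022] Thm. A (1)–(2); [BurungaleSkinnerTianWan2024] Conj. 1.12, Thm. 1.13;
[AlpogeBhargavaShnidman2022] App. A Thm. 10.8 (a), §10.1.3 (pp. 33–34), §2 after Thm. 2.10;
[Kato2004Asterisque] Thm. 12.5 (p. 222), Conj. 12.10 (p. 224), §14.14, Cor. 14.3; [BurungaleTian2026] Thm. 3.1;
[GrossZagier1986] Thm. I.6.3.
-/

noncomputable section

open scoped Classical

open WeierstrassCurve NumberField IsDedekindDomain Field Literature.NumberTheory.EllipticCurves
  Literature.NumberTheory.EllipticCurves.Kato2004 Literature.NumberTheory.EllipticCurves.IwasawaAlgebra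
  Literature.NumberTheory.EllipticCurves.Kato2004.EulerSystemValues Literature.NumberTheory.EllipticCurves.Castella2018
  Literature.NumberTheory.GaloisRepresentations
  Summit.BirchSwinnertonDyer.Rank1Residual.Additive
  Summit.BirchSwinnertonDyer.BirchSwinnertonDyer.Theses.MordellShaFreeCut
  Summit.BirchSwinnertonDyer.BirchSwinnertonDyer.Theorems.CongruentShaFreeCutKatoDescentDatumOfH2
  Summit.BirchSwinnertonDyer.BirchSwinnertonDyer.Theorems.MordellShaFreeCutKatoZetaRoadPinnedH2
open Summit.BirchSwinnertonDyer.BirchSwinnertonDyer.Theorems.MordellShaFreeCutOfHeegnerNonTorsion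
  (analyticRankOne_of_facts_of_heegnerNonTorsion)
open Summit.BirchSwinnertonDyer.BirchSwinnertonDyer.Theorems.MordellShaFreeCutKatoZetaRoadNontrivialH1
  (readingRK_jZero_three_of_nontrivialAtPin reading31_jZero_three_of_nontrivialAtPin)
open Summit.BirchSwinnertonDyer.BirchSwinnertonDyer.Theorems.CongruentShaFreeCutKatoReading31b
  (reading31b_three_of_fact)

namespace Summit.BirchSwinnertonDyer.BirchSwinnertonDyer.Theorems.MordellShaFreeCutKatoZetaRoadLogZero

/-! ## §0 The `Λ`-module generator step of Burungale–Tian Thm. 3.1 on a Kato descent datum -/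

section Skeleton

variable {p : ℕ} [Fact p.Prime] (D : KatoDescentDatum p)

/-- **Burungale–Tian's `Λ`-module step on a Kato descent datum** (statement and proof = the private lemma of
`MordellShaFreeCutKatoZetaRoadPinnedH2AtPin` §0, re-proved here because it is private there): Kato's Main
Conjecture 12.10 for `D` in `Λ ⊗ ℚ` and `H2/TH2` finite imply `p^m • ι(z̄) ≠ 0` for every `m`.
[cite: BurungaleTian2026, Thm. 3.1 (proof, p. 6: (3.1)–(3.2)) and Remark 3.2]
[cite: Kato2004Asterisque, Conj. 12.10 (p. 224) and §14.14 (14.14.1) (p. 243)] -/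
private theorem forall_pow_smul_iota_zeta_ne_zero
    (hMC : ∃ a b : ℕ,
      Ideal.span {(p : IwasawaAlgebra p) ^ a} * Module.charIdeal (IwasawaAlgebra p) D.H2 =
        Ideal.span {(p : IwasawaAlgebra p) ^ b} *
          Module.charIdeal (IwasawaAlgebra p) (D.H ⧸ (IwasawaAlgebra p) ∙ D.z))
    (hfin : Finite (IwasawaAlgebra.coinvariants p D.H2)) :
    ∀ m : ℕ, p ^ m • D.ι (Submodule.Quotient.mk D.z) ≠ 0 := by
  have hG : ∃ g ∈ ({D.z} : Set D.H), g ≠ 0 := ⟨D.z, Set.mem_singleton _, D.z_ne_zero⟩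
  obtain ⟨g, hg, h⟩ :=
    IwasawaAlgebra.exists_forall_pow_smul_mkQ_ne_zero_of_span_pow_mul_charIdeal_eq p hG
      D.isTorsion_quotient D.isTorsion_H2 hMC hfin
  rw [Set.mem_singleton_iff] at hg
  subst hg
  intro m hm
  refine h m (D.ι_injective ?_)
  rw [map_nsmul, hm, map_zero]

end Skeleton

/-! ## §1 Monotonicity: the registered research statement implies its annihilation half (V₃) -/

/-- **`PRFormulaAtThreeH2 ⟹ (V₃)`** (ACT-TEST-(i)-type certificate: the weaker statement is implied by the registered
stub). At a TORSION Heegner point `P`, read `P` through the embedding `ι : K → ℚ₃` at a degree-one prime over `3`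
(it exists by the Heegner hypothesis for `3`: `Rank1Residual.X11b.exists_anticyclotomic_generator_degreeOnePrime`,
`X11b.embAt`); Perrin-Riou's formula gives `HasLocPKummerLog W 3 pin.katoClass (c · log_ω(P)²)` for some `c`, and
`log_ω(P) = 0` (`AcPConverseLinks.padicLogPoint_formalIndex_smul_eq_zero_of_isOfFinAddOrder`), so the Kummer
logarithm is `0`. The constant `c` and its non-vanishing are not used. The converse is not claimed.
[cite: PerrinRiou1993AIF, §3.3, Conj. 3.3.2 and Formule 3.3.4 (pp. 976–977)]
[cite: BertoliniDarmonVenerucci2022, Thm. A (1)–(2)] [cite: AlpogeBhargavaShnidman2022, App. A Thm. 10.8 (a) (p. 33)] -/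
theorem logZeroAtThree_of_prFormulaH2 (hPR : PRFormulaAtThreeH2) :
    ∀ (W : WeierstrassCurve ℚ) [W.IsElliptic] [W.IsGloballyMinimal]
      [ContinuousSMul ℤ_[3] (W.tateModule 3)], W.j = 0 →
      ∀ (K : Type) [Field K] [NumberField K] (N : ℕ) [NeZero N],
        W.conductorNorm ℤ = N → IsImaginaryQuadratic K →
          SatisfiesHeegnerHypothesis N K → SatisfiesHeegnerHypothesis 3 K →
            (W.quadraticTwist (NumberField.discr K : ℚ)).entireLFunction 1 ≠ 0 →
        ∀ (P : (W.baseChange K).toAffine.Point), IsHeegnerPoint N W K P → IsOfFinAddOrder P →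
          W.entireLFunction 1 = 0 →
        ∀ (D : KatoDescentDatum 3) (pin : KatoDescentDatumPinH2 W 3 D),
          (∃ a b : ℕ,
            Ideal.span {((3 : ℕ) : IwasawaAlgebra 3) ^ a} * Module.charIdeal (IwasawaAlgebra 3) D.H2 =
              Ideal.span {((3 : ℕ) : IwasawaAlgebra 3) ^ b} *
                Module.charIdeal (IwasawaAlgebra 3) (D.H ⧸ (IwasawaAlgebra 3) ∙ D.z)) →
          HasLocPKummerLog W 3 pin.katoClass 0 := by
  intro W _ _ _ hj K _ _ N _ hN hK hHN hH3 hLK P hP hPtor hL D pin hMC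
  -- an embedding `ι : K → ℚ₃` at a degree-one prime over `3` (`3` splits in `K`)
  obtain ⟨-, -, 𝔭, -, -, h𝔭, he, hf⟩ :=
    Summit.BirchSwinnertonDyer.Rank1Residual.X11b.exists_anticyclotomic_generator_degreeOnePrime 3 K hK hH3
  set ι : K →+* ℚ_[3] := Summit.BirchSwinnertonDyer.Rank1Residual.X11b.embAt K 3 𝔭 h𝔭 he hf with hιdef
  -- Perrin-Riou's formula at `ι`, `P`, and the pinned datum; the constant and `c ≠ 0` are discarded
  obtain ⟨c, -, hPRx⟩ := hPR W hj K N hN hK hHN hH3 hLK ι P hP hL D pin hMC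
  -- a torsion point has `log_ω(P) = 0`
  have hlog : padicLogOmega W 3 ι P = 0 := by
    unfold padicLogOmega
    rw [AcPConverseLinks.padicLogPoint_formalIndex_smul_eq_zero_of_isOfFinAddOrder W 3 ι hPtor,
      zero_div]
  rwa [hlog, zero_pow two_ne_zero, mul_zero] at hPRx

/-! ## §2 The at-the-pin composition with (V₃) in place of `PRFormulaAtThreeH2` -/

/-- **Heegner points of a `j = 0` curve are non-torsion at a rank-one `Ш[3^∞]`-finite datum, from the readings
AT THE PIN and the annihilation half (V₃).** Same conclusion and same displayed readings as
`MordellShaFreeCutKatoZetaRoadPinnedH2AtPin.heegnerNonTorsion_of_prFormulaH2_of_readingsAtPin` (p515432): Kato's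
finiteness theorem `hKato`; (R+K) `hRK` asked only under the crux hypotheses; (3.1′) `h31`; (3.1″) `h31b`; and, in
place of `hPR : PRFormulaAtThreeH2`, the schema `hV` = (V₃) of the module docstring. Proof ([ABS] §10.1.3 with one
step fewer): rank `1` ⟹ `L(W,1) = 0` (Kato Cor. 14.3); the pinned datum with (K); (K) + (3.1′) ⟹ `ι[z]` not
`ℤ₃`-torsion (§0); if `P` were torsion, (V₃) would give Kummer logarithm `0`, contradicting (3.1″). No embedding
`K → ℚ₃` is chosen. CONDITIONAL on the displayed hypotheses; credits nothing.
[cite: AlpogeBhargavaShnidman2022, App. A Thm. 10.1, Thm. 10.6, §10.1.3 (pp. 33–34)]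
[cite: BurungaleTian2026, Thm. 2.6 and Thm. 3.1] [cite: Kato2004Asterisque, Conj. 12.10, §14.14, Cor. 14.3]
[cite: PerrinRiou1993AIF, §3.3, Conj. 3.3.2] -/
theorem heegnerNonTorsion_of_logZero_of_readingsAtPin
    (hKato : ∀ (W : WeierstrassCurve ℚ) [W.IsElliptic] (p : ℕ) [Fact p.Prime],
      kato_finite_of_L_one_ne_zero W p)
    (hRK : ∀ (W : WeierstrassCurve ℚ) [W.IsElliptic] [W.IsGloballyMinimal]
      [ContinuousSMul ℤ_[3] (W.tateModule 3)], W.j = 0 → W.mordellWeilRank = 1 →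
        Finite (AddCommGroup.primaryComponent W.sha 3) →
        ∃ D : KatoDescentDatum 3, Nonempty (KatoDescentDatumPinH2 W 3 D) ∧
          ∃ a b : ℕ,
            Ideal.span {((3 : ℕ) : IwasawaAlgebra 3) ^ a} * Module.charIdeal (IwasawaAlgebra 3) D.H2 =
              Ideal.span {((3 : ℕ) : IwasawaAlgebra 3) ^ b} *
                Module.charIdeal (IwasawaAlgebra 3) (D.H ⧸ (IwasawaAlgebra 3) ∙ D.z))
    (h31 : ∀ (W : WeierstrassCurve ℚ) [W.IsElliptic] [W.IsGloballyMinimal]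
      [ContinuousSMul ℤ_[3] (W.tateModule 3)] (D : KatoDescentDatum 3), W.j = 0 →
        Nonempty (KatoDescentDatumPinH2 W 3 D) → W.mordellWeilRank = 1 →
          Finite (AddCommGroup.primaryComponent W.sha 3) →
            Finite (IwasawaAlgebra.coinvariants 3 D.H2))
    (h31b : ∀ (W : WeierstrassCurve ℚ) [W.IsElliptic] [W.IsGloballyMinimal]
      [ContinuousSMul ℤ_[3] (W.tateModule 3)] (D : KatoDescentDatum 3)
      (pin : KatoDescentDatumPinH2 W 3 D), W.j = 0 → W.mordellWeilRank = 1 →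
        Finite (AddCommGroup.primaryComponent W.sha 3) →
          (∀ m : ℕ, 3 ^ m • D.ι (Submodule.Quotient.mk D.z) ≠ 0) →
            ∀ t : ℚ_[3], HasLocPKummerLog W 3 pin.katoClass t → t ≠ 0)
    (hV : ∀ (W : WeierstrassCurve ℚ) [W.IsElliptic] [W.IsGloballyMinimal]
      [ContinuousSMul ℤ_[3] (W.tateModule 3)], W.j = 0 →
      ∀ (K : Type) [Field K] [NumberField K] (N : ℕ) [NeZero N],
        W.conductorNorm ℤ = N → IsImaginaryQuadratic K →
          SatisfiesHeegnerHypothesis N K → SatisfiesHeegnerHypothesis 3 K →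
            (W.quadraticTwist (NumberField.discr K : ℚ)).entireLFunction 1 ≠ 0 →
        ∀ (P : (W.baseChange K).toAffine.Point), IsHeegnerPoint N W K P → IsOfFinAddOrder P →
          W.entireLFunction 1 = 0 →
        ∀ (D : KatoDescentDatum 3) (pin : KatoDescentDatumPinH2 W 3 D),
          (∃ a b : ℕ,
            Ideal.span {((3 : ℕ) : IwasawaAlgebra 3) ^ a} * Module.charIdeal (IwasawaAlgebra 3) D.H2 =
              Ideal.span {((3 : ℕ) : IwasawaAlgebra 3) ^ b} *
                Module.charIdeal (IwasawaAlgebra 3) (D.H ⧸ (IwasawaAlgebra 3) ∙ D.z)) →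
          HasLocPKummerLog W 3 pin.katoClass 0) :
    ∀ (W : WeierstrassCurve ℚ) [W.IsElliptic] [W.IsGloballyMinimal], W.j = 0 →
      ∀ (K : Type) [Field K] [NumberField K] (N : ℕ) [NeZero N], W.conductorNorm ℤ = N →
        IsImaginaryQuadratic K → SatisfiesHeegnerHypothesis N K → SatisfiesHeegnerHypothesis 3 K →
          (W.quadraticTwist (NumberField.discr K : ℚ)).entireLFunction 1 ≠ 0 →
            W.mordellWeilRank = 1 → Finite (AddCommGroup.primaryComponent W.sha 3) →
              ∀ (P : (W.baseChange K).toAffine.Point), IsHeegnerPoint N W K P →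
                ¬ IsOfFinAddOrder P := by
  intro W _ _ hj K _ _ N _ hN hK hHN hH3 hLK hrank hsha P hP hPtor
  haveI : ContinuousSMul ℤ_[3] (W.tateModule 3) := TateModule.continuousSMul_padicInt
  -- rank one ⟹ `L(W, 1) = 0` (Kato's finiteness theorem, Cor. 14.3)
  have hL : W.entireLFunction 1 = 0 := by
    by_contra hL1
    obtain ⟨hfin, -, -⟩ := hKato W 3 hL1
    have h0 : W.mordellWeilRank = 0 := mordellWeilRank_eq_zero_of_finite W hfin
    omega
  -- the pinned datum with Kato's main conjecture, AT THE PIN; `ι[z]` is not `ℤ₃`-torsion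
  obtain ⟨D, ⟨pin⟩, hMC⟩ := hRK W hj hrank hsha
  have hz : ∀ m : ℕ, 3 ^ m • D.ι (Submodule.Quotient.mk D.z) ≠ 0 :=
    forall_pow_smul_iota_zeta_ne_zero D hMC (h31 W D hj ⟨pin⟩ hrank hsha)
  -- (V₃) at the torsion Heegner point: the pinned Kato class has Kummer logarithm `0` — contradicting (3.1″)
  exact h31b W D pin hj hrank hsha hz 0 (hV W hj K N hN hK hHN hH3 hLK P hP hPtor hL D pin hMC) rfl

/-! ## §3 Crux B by name from the readings AT THE PIN and (V₃) -/

/-- **Crux B `AnalyticRankOneOfRankOneFiniteShaThree` (stmt-BirchSwinnertonDyer-19160) on the v2-PINNED Kato–zeta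
road with the research input weakened to (V₃).** Displayed hypotheses: the six refereed facts of the line of record
(`3`-parity, modularity, Hoffstein–Luo, Kato's finiteness theorem, Heegner points over `K`, Gross–Zagier + Kolyvagin),
the three print readings (R+K) `hRK` (at the pin), (3.1′) `h31`, (3.1″) `h31b`, and ONE research statement `hV` =
(V₃). Proof: `MordellShaFreeCutOfHeegnerNonTorsion.analyticRankOne_of_facts_of_heegnerNonTorsion` (p419697) ∘ §2.
CONDITIONAL; closes nothing. [cite: AlpogeBhargavaShnidman2022, App. A Thm. 10.1, Thm. 10.6, §10.1.3]
[cite: GrossZagier1986, Thm. I.6.3 with V.§2] [cite: Kato2004Asterisque, Cor. 14.3, §14.14] [cite: PerrinRiou1993AIF, §3.3, Conj. 3.3.2] -/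
theorem cruxB_of_logZero_of_readingsAtPin
    (hpar : ∀ (W : WeierstrassCurve ℚ) [W.IsElliptic] (p : ℕ) [Fact p.Prime], p_parity W p)
    (hmod : ModularForms.exists_isNewformOf) (hHL : HoffsteinLuo1997_exists_twist_L_one_ne_zero)
    (hKato : ∀ (W : WeierstrassCurve ℚ) [W.IsElliptic] (p : ℕ) [Fact p.Prime],
      kato_finite_of_L_one_ne_zero W p)
    (hHP : ∀ (W : WeierstrassCurve ℚ) (K : Type) [Field K] [NumberField K],
      exists_isHeegnerPoint W K)
    (hGZ : ∀ (W : WeierstrassCurve ℚ) (N : ℕ) [NeZero N] (K : Type) [Field K] [NumberField K],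
      analyticRankEK_eq_one_iff_heegner_nonTorsion W N K)
    (hRK : ∀ (W : WeierstrassCurve ℚ) [W.IsElliptic] [W.IsGloballyMinimal]
      [ContinuousSMul ℤ_[3] (W.tateModule 3)], W.j = 0 → W.mordellWeilRank = 1 →
        Finite (AddCommGroup.primaryComponent W.sha 3) →
        ∃ D : KatoDescentDatum 3, Nonempty (KatoDescentDatumPinH2 W 3 D) ∧
          ∃ a b : ℕ,
            Ideal.span {((3 : ℕ) : IwasawaAlgebra 3) ^ a} * Module.charIdeal (IwasawaAlgebra 3) D.H2 =
              Ideal.span {((3 : ℕ) : IwasawaAlgebra 3) ^ b} *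
                Module.charIdeal (IwasawaAlgebra 3) (D.H ⧸ (IwasawaAlgebra 3) ∙ D.z))
    (h31 : ∀ (W : WeierstrassCurve ℚ) [W.IsElliptic] [W.IsGloballyMinimal]
      [ContinuousSMul ℤ_[3] (W.tateModule 3)] (D : KatoDescentDatum 3), W.j = 0 →
        Nonempty (KatoDescentDatumPinH2 W 3 D) → W.mordellWeilRank = 1 →
          Finite (AddCommGroup.primaryComponent W.sha 3) →
            Finite (IwasawaAlgebra.coinvariants 3 D.H2))
    (h31b : ∀ (W : WeierstrassCurve ℚ) [W.IsElliptic] [W.IsGloballyMinimal]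
      [ContinuousSMul ℤ_[3] (W.tateModule 3)] (D : KatoDescentDatum 3)
      (pin : KatoDescentDatumPinH2 W 3 D), W.j = 0 → W.mordellWeilRank = 1 →
        Finite (AddCommGroup.primaryComponent W.sha 3) →
          (∀ m : ℕ, 3 ^ m • D.ι (Submodule.Quotient.mk D.z) ≠ 0) →
            ∀ t : ℚ_[3], HasLocPKummerLog W 3 pin.katoClass t → t ≠ 0)
    (hV : ∀ (W : WeierstrassCurve ℚ) [W.IsElliptic] [W.IsGloballyMinimal]
      [ContinuousSMul ℤ_[3] (W.tateModule 3)], W.j = 0 →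
      ∀ (K : Type) [Field K] [NumberField K] (N : ℕ) [NeZero N],
        W.conductorNorm ℤ = N → IsImaginaryQuadratic K →
          SatisfiesHeegnerHypothesis N K → SatisfiesHeegnerHypothesis 3 K →
            (W.quadraticTwist (NumberField.discr K : ℚ)).entireLFunction 1 ≠ 0 →
        ∀ (P : (W.baseChange K).toAffine.Point), IsHeegnerPoint N W K P → IsOfFinAddOrder P →
          W.entireLFunction 1 = 0 →
        ∀ (D : KatoDescentDatum 3) (pin : KatoDescentDatumPinH2 W 3 D),
          (∃ a b : ℕ,
            Ideal.span {((3 : ℕ) : IwasawaAlgebra 3) ^ a} * Module.charIdeal (IwasawaAlgebra 3) D.H2 =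
              Ideal.span {((3 : ℕ) : IwasawaAlgebra 3) ^ b} *
                Module.charIdeal (IwasawaAlgebra 3) (D.H ⧸ (IwasawaAlgebra 3) ∙ D.z)) →
          HasLocPKummerLog W 3 pin.katoClass 0) :
    AnalyticRankOneOfRankOneFiniteShaThree :=
  analyticRankOne_of_facts_of_heegnerNonTorsion hpar hmod hHL hKato hHP hGZ
    (heegnerNonTorsion_of_logZero_of_readingsAtPin hKato hRK h31 h31b hV)

/-! ## §4 The census keyed to the registered line: crux B ⟸ RI7′ ∧ (V₃) -/

/-- **CRUX B ⟸ SIX REFEREED THEOREMS ∧ (NT) ∧ (V₃), (NT) crux-local at `p = 3`** — §3 with the three readings fed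
from (NT) «`𝐇¹_Γ(T₃W) ≠ 0` at the cyclotomic pins of the rank-one `Ш[3^∞]`-finite `j = 0` curves» by the landed
`MordellShaFreeCutKatoZetaRoadNontrivialH1` §1 (`readingRK_jZero_three_of_nontrivialAtPin`,
`reading31_jZero_three_of_nontrivialAtPin`, over (α), tf, (R1), (R2)) and (3.1″) by
`reading31b_three_of_fact Kato2004.locP_kernel_isTorsion_of_rankOne_holds` — token for token the proof of
`…NontrivialH1.cruxB_of_sixFacts_of_nontrivialAtPin_of_prFormulaH2` with `hPR` ↦ `hV`. CONDITIONAL; closes nothing.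
[cite: Kato2004Asterisque, §12.2 (12.2.2) (p. 220), Thm. 12.4 (2) (p. 221), §14.14, Cor. 14.3]
[cite: AlpogeBhargavaShnidman2022, App. A Thm. 10.1, Thm. 10.6, §10.1.3] [cite: PerrinRiou1993AIF, §3.3, Conj. 3.3.2] -/
theorem cruxB_of_sixFacts_of_nontrivialAtPin_of_logZero
    (hpar : ∀ (W : WeierstrassCurve ℚ) [W.IsElliptic] (p : ℕ) [Fact p.Prime], p_parity W p)
    (hmod : ModularForms.exists_isNewformOf) (hHL : HoffsteinLuo1997_exists_twist_L_one_ne_zero)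
    (hKato : ∀ (W : WeierstrassCurve ℚ) [W.IsElliptic] (p : ℕ) [Fact p.Prime],
      kato_finite_of_L_one_ne_zero W p)
    (hHP : ∀ (W : WeierstrassCurve ℚ) (K : Type) [Field K] [NumberField K],
      exists_isHeegnerPoint W K)
    (hGZ : ∀ (W : WeierstrassCurve ℚ) (N : ℕ) [NeZero N] (K : Type) [Field K] [NumberField K],
      analyticRankEK_eq_one_iff_heegner_nonTorsion W N K)
    (hNT : ∀ (W : WeierstrassCurve ℚ) [W.IsElliptic] [ContinuousSMul ℤ_[3] (W.tateModule 3)]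
      (κ : ZpExtension ℚ 3) (γ : absoluteGaloisGroup ℚ), κ.IsCyclotomic → κ.IsTopGenerator γ →
        ∀ I : IwasawaH1Data W 3 κ γ, W.j = 0 → W.mordellWeilRank = 1 →
          Finite (AddCommGroup.primaryComponent W.sha 3) → Nontrivial I.H)
    (hV : ∀ (W : WeierstrassCurve ℚ) [W.IsElliptic] [W.IsGloballyMinimal]
      [ContinuousSMul ℤ_[3] (W.tateModule 3)], W.j = 0 →
      ∀ (K : Type) [Field K] [NumberField K] (N : ℕ) [NeZero N],
        W.conductorNorm ℤ = N → IsImaginaryQuadratic K →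
          SatisfiesHeegnerHypothesis N K → SatisfiesHeegnerHypothesis 3 K →
            (W.quadraticTwist (NumberField.discr K : ℚ)).entireLFunction 1 ≠ 0 →
        ∀ (P : (W.baseChange K).toAffine.Point), IsHeegnerPoint N W K P → IsOfFinAddOrder P →
          W.entireLFunction 1 = 0 →
        ∀ (D : KatoDescentDatum 3) (pin : KatoDescentDatumPinH2 W 3 D),
          (∃ a b : ℕ,
            Ideal.span {((3 : ℕ) : IwasawaAlgebra 3) ^ a} * Module.charIdeal (IwasawaAlgebra 3) D.H2 =
              Ideal.span {((3 : ℕ) : IwasawaAlgebra 3) ^ b} *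
                Module.charIdeal (IwasawaAlgebra 3) (D.H ⧸ (IwasawaAlgebra 3) ∙ D.z)) →
          HasLocPKummerLog W 3 pin.katoClass 0) :
    AnalyticRankOneOfRankOneFiniteShaThree :=
  cruxB_of_logZero_of_readingsAtPin hpar hmod hHL hKato hHP hGZ
    (readingRK_jZero_three_of_nontrivialAtPin hNT) (reading31_jZero_three_of_nontrivialAtPin hNT)
    (reading31b_three_of_fact locP_kernel_isTorsion_of_rankOne_holds) hV

/-- **Crux B from the BUNDLED, REGISTERED RI7′ and the annihilation half (V₃).** `RI` is, token for token, the
registered signature of `stub_refereedInputs` on stmt-BirchSwinnertonDyer-19160 (six refereed theorems ∧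
`Kato2004.one_le_rank_iwasawaH1`); `hV` is (V₃). Since
`cruxB_of_registeredRI7prime_of_logZero RI (logZeroAtThree_of_prFormulaH2 hPR)` has exactly the type of
`…NontrivialH1.cruxB_of_registeredRI7prime_of_prFormulaH2 RI hPR` (p526335), this records: the registered line's research stub may be WEAKENED from `PRFormulaAtThreeH2` to
(V₃) with the same citation-borne stub and the same composition idea (a design datum; no registry act implied).
CONDITIONAL; closes nothing; nothing about RI7′ or (V₃) is proved here.
[cite: Kato2004Asterisque, §12.2 (12.2.2) (p. 220), Cor. 14.3] [cite: DokchitserDokchitserAnnals2010, Thm. 1.4]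
[cite: GrossZagier1986, Thm. I.6.3 with V.§2] [cite: Gross1984, §§3–4] [cite: PerrinRiou1993AIF, §3.3, Conj. 3.3.2] -/
theorem cruxB_of_registeredRI7prime_of_logZero
    (RI : (∀ (W : WeierstrassCurve ℚ) [W.IsElliptic] (p : ℕ) [Fact p.Prime], p_parity W p) ∧
      ModularForms.exists_isNewformOf ∧
      HoffsteinLuo1997_exists_twist_L_one_ne_zero ∧
      (∀ (W : WeierstrassCurve ℚ) [W.IsElliptic] (p : ℕ) [Fact p.Prime],
        kato_finite_of_L_one_ne_zero W p) ∧
      (∀ (W : WeierstrassCurve ℚ) (K : Type) [Field K] [NumberField K], exists_isHeegnerPoint W K) ∧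
      (∀ (W : WeierstrassCurve ℚ) (N : ℕ) [NeZero N] (K : Type) [Field K] [NumberField K],
        analyticRankEK_eq_one_iff_heegner_nonTorsion W N K) ∧
      one_le_rank_iwasawaH1)
    (hV : ∀ (W : WeierstrassCurve ℚ) [W.IsElliptic] [W.IsGloballyMinimal]
      [ContinuousSMul ℤ_[3] (W.tateModule 3)], W.j = 0 →
      ∀ (K : Type) [Field K] [NumberField K] (N : ℕ) [NeZero N],
        W.conductorNorm ℤ = N → IsImaginaryQuadratic K →
          SatisfiesHeegnerHypothesis N K → SatisfiesHeegnerHypothesis 3 K →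
            (W.quadraticTwist (NumberField.discr K : ℚ)).entireLFunction 1 ≠ 0 →
        ∀ (P : (W.baseChange K).toAffine.Point), IsHeegnerPoint N W K P → IsOfFinAddOrder P →
          W.entireLFunction 1 = 0 →
        ∀ (D : KatoDescentDatum 3) (pin : KatoDescentDatumPinH2 W 3 D),
          (∃ a b : ℕ,
            Ideal.span {((3 : ℕ) : IwasawaAlgebra 3) ^ a} * Module.charIdeal (IwasawaAlgebra 3) D.H2 =
              Ideal.span {((3 : ℕ) : IwasawaAlgebra 3) ^ b} *
                Module.charIdeal (IwasawaAlgebra 3) (D.H ⧸ (IwasawaAlgebra 3) ∙ D.z)) →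
          HasLocPKummerLog W 3 pin.katoClass 0) :
    AnalyticRankOneOfRankOneFiniteShaThree :=
  cruxB_of_sixFacts_of_nontrivialAtPin_of_logZero RI.1 RI.2.1 RI.2.2.1 RI.2.2.2.1 RI.2.2.2.2.1
    RI.2.2.2.2.2.1
    (fun W _ _ κ γ hκ hγ I _ _ _ ↦
      Kato2004.nontrivial_of_one_le_rank_iwasawaH1 RI.2.2.2.2.2.2 W 3 κ γ hκ hγ I) hV

end Summit.BirchSwinnertonDyer.BirchSwinnertonDyer.Theorems.MordellShaFreeCutKatoZetaRoadLogZero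

end
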